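/- Width seat `ym-line-sfw-p2-w5` (prover-ym-line-sfw-p2-w5-g18-0), free hands on planner ym-idea-2 g16's LINE-19 task board (STUB-PLAN-S4b §11,
board item «layer-cake `GradKernelEnergyDecay → H4b1one` (S)»; crux `AllWindowsColdBox.BoxHighWindowsSU22` = stmt-QuantumFields-24004 / 24335, stub S4b). -/
import Summits.QuantumFields.YangMills.Theorems.AllWindowsColdBoxBoxHighLineGradKernelEnergy

/-!
# LINE-19 S4b §11, the layer cake: energy decay of the gradient-kernel row ⇒ the ℓ¹ row sum H4b.1 (one log) — `h4b1one_of_energyDecay`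

The dyadic layer-cake argument that turns the §11 energy decay `GradKernelEnergyDecay`
(`Σ_{p : d(e,p) ≥ j} ((hodgeQ⁻¹λ_p)_e)² ≤ C(1+log H)²/(1+j)²`) into the ℓ¹ row bound `H4b1one`
(`Σ_p |(hodgeQ⁻¹λ_p)_e| ≤ C'·H·(1+log H)`) of the S4b bootstrap:

* split the plaquettes of the Hodge system into dyadic shells `2^k ≤ 1 + d(e,p) < 2^{k+1}` (`k = Nat.log 2 (1 + d)`, `kOf`);
* on shell `k` use AM–GM with weight `t_k = (1+log H)·8^{-k}` (`abs_le_half_add_sq_div`, no square roots):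
  `Σ_shell |G| ≤ ½(t_k·#shell + E_{2^k−1}/t_k)`, where `#shell ≤ #{d ≤ 2^{k+1}} ≤ 16·(2·2^{k+1}+1)⁴ ≤ 10⁴·16^k`
  (`card_hodgePlaqs_filter_dist_le`, injection into a cube of `ℤ⁴` × the 16 direction pairs, `ShellSum.card_cube`) and
  `E_{2^k−1} ≤ C(1+log H)²/4^k`; both halves are `≲ (1+log H)·2^k`;
* `Σ_{k ≤ K} 2^k < 2^{K+1} ≤ 2(8H+9) ≤ 34H` because `d(e,p) ≤ 8H+8` on the enlarged box (`edgePlaqDist_le`).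

Result: **`h4b1one_of_energyDecay : GradKernelEnergyDecay → H4b1one`** (explicit constant `34·(5000 + C/2)` for decay constant `C ≥ 0`).
Everything proved; one harmless definition (`kOf`, the dyadic shell index); standard axioms.  HONEST LABEL: a counting helper toward ONE
registered stub (S4b) of a critic-PASSed line on the R2ξ″ RECORD-rung crux 24004 / 24335; `GradKernelEnergyDecay` itself is OPEN; no stub is
proved by name, no crux, rung or summit is proved; the Yang–Mills mass gap is NOT proved by this file.
-/

set_option autoImplicit false

noncomputable section

open Finset Matrix
open Literature.MathematicalPhysics.QuantumFieldTheory
open Literature.MathematicalPhysics.QuantumFieldTheory.LatticeMaxwell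
open Literature.MathematicalPhysics.QuantumFieldTheory.AxialGauge
open Summit.QuantumFields.YangMills.Theorems.WeakCouplingRates
open Summit.QuantumFields.YangMills.Theorems.AllWindowsColdBox
open Summit.QuantumFields.YangMills.Theorems.AllWindowsColdBox.ShellSum
open Literature.Probability.LatticeModels (Site mem_halfOpenBox halfOpenBox)

namespace Summit.QuantumFields.YangMills.Theorems.AllWindowsColdBoxBoxHighLine

/-! ## Elementary pieces -/

/-- AM–GM without square roots: `|a| ≤ (t + a²/t)/2` for `t > 0`. -/
theorem abs_le_half_add_sq_div {a t : ℝ} (ht : 0 < t) : |a| ≤ (t + a ^ 2 / t) / 2 := by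
  have hmul : (t + a ^ 2 / t) * t = t ^ 2 + a ^ 2 := by
    field_simp
  have h1 : |a| * 2 * t ≤ (t + a ^ 2 / t) * t := by
    rw [hmul, ← sq_abs a]
    nlinarith [sq_nonneg (|a| - t), abs_nonneg a]
  have h2 : |a| * 2 ≤ t + a ^ 2 / t := le_of_mul_le_mul_right h1 ht
  linarith

/-- The edge–plaquette distance is nonnegative. -/
theorem edgePlaqDist_nonneg {H : ℕ} (e : LandauFree H) (p : Plaq 4) : 0 ≤ edgePlaqDist e p :=
  Finset.sum_nonneg fun _ _ => abs_nonneg _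

/-- On the enlarged box the edge–plaquette distance is at most `8H + 8`. -/
theorem edgePlaqDist_le {H : ℕ} (e : LandauFree H) {p : Plaq 4} (hp : p ∈ hodgePlaqs H) :
    edgePlaqDist e p ≤ 8 * (H : ℤ) + 8 := by
  classical
  have hx : ∀ m, -1 ≤ e.1.1.1 m ∧ e.1.1.1 m ≤ 2 * (H : ℤ) + 1 := fun m => by
    have hmem := LatticeMaxwell.mem_boxEdgesAt.1 e.1.2
    rcases e' : e.1.1 with ⟨y, i⟩
    rw [e'] at hmem
    have hk := ((mem_boxEdges_iff.1 hmem).1) m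
    simp only [Pi.sub_apply, dirCorner] at hk
    show -1 ≤ y m ∧ y m ≤ 2 * (H : ℤ) + 1
    push_cast at hk
    constructor <;> omega
  unfold hodgePlaqs at hp
  obtain ⟨q, hq, rfl⟩ := Finset.mem_image.1 hp
  have hq1 : q.1 ∈ halfOpenBox 4 (2 * H + 3) :=
    (Finset.mem_product.1 (DirResponse.plaquettesIn_subset_product _ hq)).1
  have hy := mem_halfOpenBox.1 hq1
  unfold edgePlaqDist
  calc ∑ m : Fin 4, |e.1.1.1 m - (Plaq.shift dirCorner q).1 m| ≤ ∑ _m : Fin 4, (2 * (H : ℤ) + 2) := by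
        refine Finset.sum_le_sum fun m _ => ?_
        have h1 := hx m
        have h2 := hy m
        simp only [Plaq.shift_fst, Pi.add_apply, dirCorner]
        rw [abs_le]
        push_cast at h2 ⊢
        constructor <;> omega
    _ = 8 * (H : ℤ) + 8 := by simp; ring

/-- **Counting**: the plaquettes of the Hodge system within edge–plaquette distance `R` of `e` number at most `16·(2R+1)⁴`
(inject `p ↦ (p.1 − base e, directions)` into the cube of radius `R` times the `16` direction pairs). -/
theorem card_hodgePlaqs_filter_dist_le {H : ℕ} (e : LandauFree H) (R : ℕ) :
    #((hodgePlaqs H).filter (fun p => edgePlaqDist e p ≤ R)) ≤ 16 * (2 * R + 1) ^ 4 := by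
  classical
  set S := (hodgePlaqs H).filter (fun p => edgePlaqDist e p ≤ R) with hS
  set φ : Plaq 4 → (Fin 4 → ℤ) × (Fin 4 × Fin 4) := fun p => (fun m => p.1 m - e.1.1.1 m, p.2) with hφ
  have hinj : Set.InjOn φ (S : Set (Plaq 4)) := by
    intro p _ q _ h
    simp only [hφ, Prod.mk.injEq] at h
    obtain ⟨h1, h2⟩ := h
    refine Prod.ext ?_ h2
    funext m
    have := congr_fun h1 m
    simpa using this
  set T : Finset ((Fin 4 → ℤ) × (Fin 4 × Fin 4)) :=
    (Fintype.piFinset (fun _ : Fin 4 => Finset.Icc (-(R : ℤ)) R)) ×ˢ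
      ((Finset.univ : Finset (Fin 4)) ×ˢ (Finset.univ : Finset (Fin 4))) with hT
  have hmaps : Set.MapsTo φ (S : Set (Plaq 4)) (T : Set ((Fin 4 → ℤ) × (Fin 4 × Fin 4))) := by
    intro p hp
    have hd : edgePlaqDist e p ≤ R := (Finset.mem_filter.1 (Finset.mem_coe.1 hp)).2
    rw [Finset.mem_coe, hT, Finset.mem_product]
    refine ⟨?_, Finset.mem_product.2 ⟨Finset.mem_univ _, Finset.mem_univ _⟩⟩
    rw [mem_cube]
    intro m
    have hle : |e.1.1.1 m - p.1 m| ≤ edgePlaqDist e p := by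
      unfold edgePlaqDist
      exact Finset.single_le_sum (f := fun m' => |e.1.1.1 m' - p.1 m'|) (fun _ _ => abs_nonneg _) (Finset.mem_univ m)
    simp only [hφ]
    rw [abs_sub_comm]
    exact hle.trans hd
  calc #S ≤ #T := Finset.card_le_card_of_injOn φ hmaps hinj
    _ = 16 * (2 * R + 1) ^ 4 := by
        rw [hT, Finset.card_product, card_cube, Finset.card_product, Finset.card_univ, Fintype.card_fin]
        ring

/-- The dyadic shell index of a plaquette: `k = log₂ (1 + d(e,p))`. -/
def kOf {H : ℕ} (e : LandauFree H) (p : Plaq 4) : ℕ := Nat.log 2 (1 + edgePlaqDist e p).toNat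

/-- Shell membership: `2^k ≤ 1 + d < 2^{k+1}` for `k = kOf e p`. -/
theorem pow_kOf_le {H : ℕ} (e : LandauFree H) (p : Plaq 4) :
    (2 : ℤ) ^ kOf e p ≤ 1 + edgePlaqDist e p ∧ 1 + edgePlaqDist e p < (2 : ℤ) ^ (kOf e p + 1) := by
  have hd := edgePlaqDist_nonneg e p
  have hn : (1 + edgePlaqDist e p).toNat ≠ 0 := by
    intro h
    rw [Int.toNat_eq_zero] at h
    linarith
  have h1 : 2 ^ kOf e p ≤ (1 + edgePlaqDist e p).toNat := Nat.pow_log_le_self 2 hn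
  have h2 : (1 + edgePlaqDist e p).toNat < 2 ^ (kOf e p + 1) := Nat.lt_pow_succ_log_self (by norm_num) _
  have hcast : (((1 + edgePlaqDist e p).toNat : ℕ) : ℤ) = 1 + edgePlaqDist e p := Int.toNat_of_nonneg (by linarith)
  constructor
  · have := (Int.ofNat_le.2 h1); push_cast at this; rwa [hcast] at this
  · have := (Int.ofNat_lt.2 h2); push_cast at this; rwa [hcast] at this

/-- The shell index is at most `log₂(8H+9)` on the enlarged box. -/
theorem kOf_le {H : ℕ} (e : LandauFree H) {p : Plaq 4} (hp : p ∈ hodgePlaqs H) :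
    kOf e p ≤ Nat.log 2 (8 * H + 9) := by
  unfold kOf
  refine Nat.log_mono_right ?_
  have h := edgePlaqDist_le e hp
  have hd := edgePlaqDist_nonneg e p
  have : (1 + edgePlaqDist e p).toNat ≤ 8 * H + 9 := by
    rw [Int.toNat_le]; push_cast; linarith
  exact this

/-! ## The layer cake -/

/-- Powers of two bookkeeping: `4^k = (2^k)²`, `8^k = (2^k)³`, `16^k = (2^k)⁴`. -/
theorem pow_four_eight_sixteen (k : ℕ) :
    (4 : ℝ) ^ k = ((2 : ℝ) ^ k) ^ 2 ∧ (8 : ℝ) ^ k = ((2 : ℝ) ^ k) ^ 3 ∧ (16 : ℝ) ^ k = ((2 : ℝ) ^ k) ^ 4 := by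
  refine ⟨?_, ?_, ?_⟩
  · rw [show (4 : ℝ) = 2 ^ 2 by norm_num, ← pow_mul, mul_comm, pow_mul]
  · rw [show (8 : ℝ) = 2 ^ 3 by norm_num, ← pow_mul, mul_comm, pow_mul]
  · rw [show (16 : ℝ) = 2 ^ 4 by norm_num, ← pow_mul, mul_comm, pow_mul]

/-- **H4b.1 (one log) from the §11 energy decay**: `GradKernelEnergyDecay → H4b1one`. -/
theorem h4b1one_of_energyDecay (hE : GradKernelEnergyDecay) : H4b1one := by
  classical
  obtain ⟨C, hC⟩ := hE
  set C' : ℝ := max C 0 with hC'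
  have hC'0 : 0 ≤ C' := le_max_right _ _
  have hCC' : C ≤ C' := le_max_left _ _
  refine ⟨34 * (5000 + C' / 2), fun H hH e => ?_⟩
  set L : ℝ := 1 + Real.log H with hL
  have hH1 : (1 : ℝ) ≤ H := by exact_mod_cast hH
  have hL1 : 1 ≤ L := by have := Real.log_nonneg hH1; rw [hL]; linarith
  have hL0 : 0 < L := by linarith
  set G : Plaq 4 → ℝ := fun p => ((hodgeQ H)⁻¹ *ᵥ landauCoeff H p) e with hG
  change ∑ p ∈ hodgePlaqs H, |G p| ≤ 34 * (5000 + C' / 2) * (H : ℝ) * L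
  -- Step 1: decompose the plaquettes of the Hodge system into dyadic shells `kOf e p = k`, `k ≤ K`
  set K : ℕ := Nat.log 2 (8 * H + 9) with hK
  rw [← Finset.sum_fiberwise_of_maps_to (s := hodgePlaqs H) (t := Finset.range (K + 1)) (g := kOf e)
    (fun p hp => Finset.mem_range.2 (Nat.lt_succ_of_le (kOf_le e hp)))]
  -- Step 2: the bound on one shell
  have hshell : ∀ k : ℕ, ∑ p ∈ (hodgePlaqs H).filter (fun p => kOf e p = k), |G p| ≤ (5000 + C' / 2) * L * 2 ^ k := by
    intro k
    obtain ⟨h4, h8, h16⟩ := pow_four_eight_sixteen k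
    set a : ℝ := (2 : ℝ) ^ k with ha
    have ha1 : 1 ≤ a := one_le_pow₀ (by norm_num)
    have ha0 : 0 < a := by linarith
    set S := (hodgePlaqs H).filter (fun p => kOf e p = k) with hS
    set t : ℝ := L / 8 ^ k with ht
    have ht0 : 0 < t := by positivity
    -- (i) AM–GM termwise
    have h1 : ∑ p ∈ S, |G p| ≤ ∑ p ∈ S, (t + G p ^ 2 / t) / 2 :=
      Finset.sum_le_sum fun p _ => abs_le_half_add_sq_div ht0
    have h2 : ∑ p ∈ S, (t + G p ^ 2 / t) / 2 = t * #S / 2 + (∑ p ∈ S, G p ^ 2) / (2 * t) := by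
      rw [← Finset.sum_div, Finset.sum_add_distrib, Finset.sum_const, nsmul_eq_mul, ← Finset.sum_div]
      field_simp
    -- (ii) the shell is inside the ball of radius `2^(k+1)`, which has `≤ 16 (2·2^(k+1)+1)⁴ ≤ 10⁴·16^k` plaquettes
    have hsub : S ⊆ (hodgePlaqs H).filter (fun p => edgePlaqDist e p ≤ ((2 ^ (k + 1) : ℕ) : ℤ)) := by
      intro p hp
      rw [Finset.mem_filter] at hp ⊢
      refine ⟨hp.1, ?_⟩
      have hlt := (pow_kOf_le e p).2
      rw [hp.2] at hlt
      push_cast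
      linarith
    have hcard : (#S : ℝ) ≤ 10000 * 16 ^ k := by
      have hc1 : #S ≤ 16 * (2 * 2 ^ (k + 1) + 1) ^ 4 :=
        (Finset.card_le_card hsub).trans (card_hodgePlaqs_filter_dist_le e (2 ^ (k + 1)))
      have hc2 : (#S : ℝ) ≤ 16 * (2 * 2 ^ (k + 1) + 1) ^ 4 := by exact_mod_cast hc1
      refine hc2.trans ?_
      rw [h16, pow_succ]
      have hb : (2 * (2 ^ k * 2) + 1 : ℝ) ≤ 5 * a := by rw [ha]; linarith
      have hb0 : (0 : ℝ) ≤ 2 * (2 ^ k * 2) + 1 := by positivity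
      calc (16 : ℝ) * (2 * (2 ^ k * 2) + 1) ^ 4 ≤ 16 * (5 * a) ^ 4 :=
            mul_le_mul_of_nonneg_left (pow_le_pow_left₀ hb0 hb 4) (by norm_num)
        _ = 10000 * a ^ 4 := by ring
    -- (iii) the shell is outside the ball of radius `2^k − 1`, where the energy decay applies
    have hsub' : S ⊆ (hodgePlaqs H).filter (fun p => (((2 ^ k - 1 : ℕ)) : ℤ) ≤ edgePlaqDist e p) := by
      intro p hp
      rw [Finset.mem_filter] at hp ⊢
      refine ⟨hp.1, ?_⟩
      have hle := (pow_kOf_le e p).1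
      rw [hp.2] at hle
      rw [Nat.cast_sub Nat.one_le_two_pow]
      push_cast
      linarith
    have henergy : ∑ p ∈ S, G p ^ 2 ≤ C' * L ^ 2 / a ^ 2 := by
      have hj := hC H hH e (2 ^ k - 1)
      have hcast : (1 : ℝ) + (((2 ^ k - 1 : ℕ)) : ℝ) = a := by
        rw [Nat.cast_sub Nat.one_le_two_pow]; push_cast; rw [ha]; ring
      rw [hcast] at hj
      calc ∑ p ∈ S, G p ^ 2 ≤ ∑ p ∈ (hodgePlaqs H).filter (fun p => (((2 ^ k - 1 : ℕ)) : ℤ) ≤ edgePlaqDist e p), G p ^ 2 :=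
            Finset.sum_le_sum_of_subset_of_nonneg hsub' fun _ _ _ => sq_nonneg _
        _ ≤ C * L ^ 2 / a ^ 2 := hj
        _ ≤ C' * L ^ 2 / a ^ 2 := by
            refine div_le_div_of_nonneg_right ?_ (by positivity)
            exact mul_le_mul_of_nonneg_right hCC' (by positivity)
    -- (iv) combine
    have hsum0 : 0 ≤ ∑ p ∈ S, G p ^ 2 := Finset.sum_nonneg fun _ _ => sq_nonneg _
    calc ∑ p ∈ S, |G p| ≤ t * #S / 2 + (∑ p ∈ S, G p ^ 2) / (2 * t) := h1.trans h2.le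
      _ ≤ t * (10000 * 16 ^ k) / 2 + (C' * L ^ 2 / a ^ 2) / (2 * t) := by
          refine add_le_add ?_ ?_
          · exact div_le_div_of_nonneg_right (mul_le_mul_of_nonneg_left hcard ht0.le) (by norm_num)
          · exact div_le_div_of_nonneg_right henergy (by positivity)
      _ = (5000 + C' / 2) * L * a := by
          rw [ht, h8, h16]
          field_simp
          ring
  -- Step 3: sum the dyadic series, `Σ_{k ≤ K} 2^k < 2^(K+1) ≤ 2 (8H+9) ≤ 34 H`
  have hgeom : ∑ k ∈ Finset.range (K + 1), (2 : ℝ) ^ k ≤ 34 * (H : ℝ) := by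
    rw [geom_sum_eq (by norm_num : (2 : ℝ) ≠ 1)]
    have hKle : (2 : ℝ) ^ K ≤ 8 * H + 9 := by
      have h := Nat.pow_log_le_self 2 (show 8 * H + 9 ≠ 0 by omega)
      rw [← hK] at h
      exact_mod_cast h
    rw [pow_succ]
    have : ((2 : ℝ) ^ K * 2 - 1) / (2 - 1) = 2 ^ K * 2 - 1 := by norm_num
    rw [this]
    nlinarith
  have hconst : 0 ≤ (5000 + C' / 2) * L := by positivity
  calc ∑ k ∈ Finset.range (K + 1), ∑ p ∈ (hodgePlaqs H).filter (fun p => kOf e p = k), |G p|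
      ≤ ∑ k ∈ Finset.range (K + 1), (5000 + C' / 2) * L * 2 ^ k := Finset.sum_le_sum fun k _ => hshell k
    _ = (5000 + C' / 2) * L * ∑ k ∈ Finset.range (K + 1), (2 : ℝ) ^ k := by rw [Finset.mul_sum]
    _ ≤ (5000 + C' / 2) * L * (34 * H) := mul_le_mul_of_nonneg_left hgeom hconst
    _ = 34 * (5000 + C' / 2) * (H : ℝ) * L := by ring

end Summit.QuantumFields.YangMills.Theorems.AllWindowsColdBoxBoxHighLine

end
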